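import Summits.QuantumFields.QCD.Theses.GaussianLinkFrames
import Summits.QuantumFields.QCD.Theorems.PauliWegnerSeaFMClosureUnquenchedSplitC3

/-!
# Crux `FrameFMClosure` (stmt-QuantumFields-17375) — the crux AS TYPED from the four sub-statements of the
# sibling split (`--supports stmt-QuantumFields-17375`, closes nothing)

`FrameFMClosure = FrameAPrioriBound → Core` and `Core` is byte-identical with the core of the sibling crux
`PauliWegnerSea.FMClosureUnquenched` (stmt-QuantumFields-11512): `frameFMClosure_iff_core` below is `Iff.rfl` over
the landed abbreviations `Input` / `Conclusion` of `Theorems/PauliWegnerSeaFMClosureUnquenchedDefs.lean`.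
Hence the crux-strategist's certified four-way decomposition of 11512 (`Cruxes/FMClosureUnquenched/SPLIT.md`,
children `TwoStarPackage` / `FarCollarStability` / `InwardCore` / `UnitShellSign`) decomposes THIS crux with the
same children, signature for signature, and the frame hypothesis unused:

`frameFMClosure_of_subs : (∀ N_f, TwoStarBounds N_f) → (∀ N_f, FarStability N_f) → InwardCore →
  (∀ N_f, UnitShellLowerBound N_f) → FrameFMClosure`

(the inward core is written INLINE — no new definition — exactly as the hypothesis `hin` of the landed merge
`VonMisesCirclesC3.conclusion_of_outward_of_inward`, universally over `(N_f, reg, m > 0, Input)`).  Real proof: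
the averaged two-star package and far stability feed the landed outward closure `VonMisesCirclesC1.stub_closure`
(p119549; with `collarResolventBounds_holds` p77083, `hoppingDecay_holds` p75265 and the unit-shell lower bound for
the `ℓ₀ = 1 ∧ |β_k| ≤ β₀` corner of the input as typed), the outward package is read as a bound beyond
`K₀ (1 + |log a_k|) ≤ a_k ‖v‖`, the inward core supplies the window, `conclusion_of_outward_of_inward` (p154380)
merges.  This is the kernel-checked content of the line lead's `promote-stub` on the registered corner stub
`stub_corners` of line `pad-the-fibre`: promoting the corner to the two items `InwardCore` (crux) + `UnitShellSign`
(support) of the sibling split — ONE staffing for both routes — leaves this crux closed modulo exactly the four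
children, by `fun h₁ h₂ h₃ h₄ => frameFMClosure_of_subs h₁ h₂ h₃ h₄`.  `inwardCore_of_frameFMClosure` records that the
split asks nothing the crux as typed does not already contain (given its own antecedent).

References: Aizenman–Schenker–Friedrich–Hundertmark, CMP 224 (2001) 219, §2 and Thm 2 [AizenmanEtAl2001].
-/

noncomputable section

namespace Summit.QuantumFields.QCD.Theorems.FrameFMClosureSplit

open scoped BigOperators Topology
open MeasureTheory Filter
open Literature.MathematicalPhysics.QuantumFieldTheory Literature.MathematicalPhysics.QuantumLattice
  Literature.Probability.LatticeModels
open Summit.QuantumFields.QCD.Theorems.VonMisesCircles Summit.QuantumFields.QCD.Theorems.VonMisesCirclesC1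
  Summit.QuantumFields.QCD.Theorems.VonMisesCirclesC2 Summit.QuantumFields.QCD.Theorems.VonMisesCirclesC3

/-- `FrameFMClosure` is LITERALLY `FrameAPrioriBound → ∀ N_f reg m > 0, Input → Conclusion` over the landed
abbreviations of `…FMClosureUnquenchedDefs` (definitional unfolding; the same `Iff.rfl` as the skeleton's `frame_iff`
and the standing disprover's `frameFMClosure_iff`). [folklore] -/
theorem frameFMClosure_iff_core :
    Summit.QuantumFields.QCD.Theses.GaussianLinkFrames.FrameFMClosure ↔
      (Summit.QuantumFields.QCD.Theses.GaussianLinkFrames.FrameAPrioriBound →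
        ∀ (Nf : ℕ) (reg : QCDRegularisation Nf) (m : Fin Nf → ℝ), (∀ f, 0 < m f) →
          Input Nf reg m → Conclusion Nf reg m) :=
  Iff.rfl

/-- **The crux AS TYPED from the four children of the sibling split.**  The averaged two-star package
`∀ N_f, TwoStarBounds N_f`, far stability `∀ N_f, FarStability N_f`, the INWARD core (inline: inside every log window
`a_k ‖v‖ ≤ K (1 + |log a_k|)` the phase-quenched fractional moment decays at a physical rate with a k-uniform
constant, for every `(N_f, reg, m > 0)` with the one-scale `Input`) and the unit-shell lower bound
`∀ N_f, UnitShellLowerBound N_f` imply `FrameFMClosure`; the route's antecedent `FrameAPrioriBound` is introduced and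
not used.  Glue of the proposed promotion of the corner stub `stub_corners` (line `pad-the-fibre`) to the items
`InwardCore` + `UnitShellSign` shared with stmt-QuantumFields-11512. [cite: AizenmanEtAl2001, §2 and Thm 2] -/
theorem frameFMClosure_of_subs :
    (∀ Nf : ℕ, TwoStarBounds Nf) → (∀ Nf : ℕ, FarStability Nf) →
      (∀ (Nf : ℕ) (reg : QCDRegularisation Nf) (m : Fin Nf → ℝ), (∀ f, 0 < m f) → Input Nf reg m →
        ∀ K : ℝ, ∃ s δ C : ℝ, 0 < s ∧ s < 1 ∧ 0 < δ ∧ ∀ᶠ k in atTop, ∀ S : ℕ, reg.L k ≤ S →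
          ∀ (f : Fin Nf) (v : Literature.Probability.LatticeModels.Site 4), v ∈ box 4 S →
            reg.a k * ‖v‖ ≤ K * (1 + |Real.log (reg.a k)|) →
              cruxMoment Nf (reg.β k) (bareMass reg m k) S f v s ≤ C * Real.exp (-(δ * (reg.a k * ‖v‖)))) →
        (∀ Nf : ℕ, UnitShellLowerBound Nf) →
          Summit.QuantumFields.QCD.Theses.GaussianLinkFrames.FrameFMClosure := by
  intro hT hF hIn hU
  rw [frameFMClosure_iff_core]
  intro _hA Nf reg m hm hin
  obtain ⟨s, δ, C, K₀, ℓ₀, hs0, hs1, hδ, _hC, hwin, -, hdec⟩ :=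
    stub_closure Nf reg m hm (hT Nf) (hF Nf) collarResolventBounds_holds (hU Nf) (hoppingDecay_holds Nf) hin
  refine conclusion_of_outward_of_inward reg m ⟨s, δ, C, K₀, hs0, hs1, hδ, ?_⟩ (hIn Nf reg m hm hin)
  filter_upwards [hwin, hdec] with k hkwin hk S hS f v hv hfar
  have hℓ : (ℓ₀ k f : ℝ) ≤ ‖v‖ := by
    have ha : 0 < reg.a k := reg.a_pos k
    have h1 : (ℓ₀ k f : ℝ) * reg.a k ≤ reg.a k * ‖v‖ := (hkwin f).trans hfar
    nlinarith
  exact hk S hS f v hv hℓ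

/-- Conversely the split asks nothing new on the inward side: given its own antecedent, the crux AS TYPED already
contains the inward core (the guard `a_k ‖v‖ ≤ K (1 + |log a_k|)` is simply discarded). [folklore] -/
theorem inwardCore_of_frameFMClosure
    (hA : Summit.QuantumFields.QCD.Theses.GaussianLinkFrames.FrameAPrioriBound)
    (h : Summit.QuantumFields.QCD.Theses.GaussianLinkFrames.FrameFMClosure) :
    ∀ (Nf : ℕ) (reg : QCDRegularisation Nf) (m : Fin Nf → ℝ), (∀ f, 0 < m f) → Input Nf reg m →
      ∀ K : ℝ, ∃ s δ C : ℝ, 0 < s ∧ s < 1 ∧ 0 < δ ∧ ∀ᶠ k in atTop, ∀ S : ℕ, reg.L k ≤ S →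
        ∀ (f : Fin Nf) (v : Literature.Probability.LatticeModels.Site 4), v ∈ box 4 S →
          reg.a k * ‖v‖ ≤ K * (1 + |Real.log (reg.a k)|) →
            cruxMoment Nf (reg.β k) (bareMass reg m k) S f v s ≤ C * Real.exp (-(δ * (reg.a k * ‖v‖))) := by
  intro Nf reg m hm hIn K
  obtain ⟨s, δ, C, hs0, hs1, hδ, hev⟩ := frameFMClosure_iff_core.mp h hA Nf reg m hm hIn
  exact ⟨s, δ, C, hs0, hs1, hδ, hev.mono fun k hk S hS f v hv _ => hk S hS f v hv⟩

end Summit.QuantumFields.QCD.Theorems.FrameFMClosureSplit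

end
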